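import Summits.QuantumFields.BalabanUV.Beta.GAN24.ExchangeSlotResum
import Summits.QuantumFields.BalabanUV.Beta.GAN24.DressedMultiplierVertexZero
import Summits.QuantumFields.BalabanUV.Beta.GAN24.EEWordReduced

/-!
# `BalabanUV.Beta.GAN24.MultiplierWordsZero` — binder row G-an2-4 ∕ (CONV-C), W-slot CT-W, conservation law (C)∕(C)sym, step (L3) of this lineage's note
# `HOME/b2b-balaban-gan24-formalise-leaf-04/g65/CSYM-LEVEL0-KERNEL-BLUEPRINT.md` §6: **EVERY TWO-FACE WORD OF THE DRESSED ONE-STEP SOURCE THAT CONTAINS A MULTIPLIER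
# HALF-VERTEX `vertexOfM X̃♮_j Lc M` VANISHES IN THE ZERO MODE** — on the lattice-summed bond directly ((S2c): `DressedMultiplierVertexZero.hasSum_vertexOfM_dressedStep` through
# `ExchangeSlotResum`), on the cell-summed bond after the lattice sum is moved across by joint coarse-bond covariance (`ExchangeSlotResum.tsum_eq_tsum_of_cov`)

NOT IN PRINT; OUR BOOKKEEPING ([folklore] BY NAME over this lineage's `ExchangeSlotResum` (generic slot resummation ∕ zero ∕ covariance swap) and `DressedMultiplierVertexZero` ((S2c) for the
dressed kernel), an2's `SecondOrderResponse.vertexOfM ∕ vertexFamily_vertexOfM ∕ vertexOfM_shiftK_translate₂`, `AxialDressingRooted.decays_coDressKBmAt`, `OneStepKernelFamily.decays_KInvStep`,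
`EEWordReduced.shiftK_dressedStep`, an5's `TameKernelCalculus` (`Loc ∕ Spr ∕ comp_assoc_tame`), `BalabanStepJetsSucc.biLoc_comp_right`, `ExpKernelCalculus.biLoc_comp_decays`; G-an2-4
formalisation swarm, leaf prover `b2b-balaban-gan24-formalise-leaf-04`, gen 66).  HONEST FRAMING (cell contract, verbatim): «discharging `BetaPertH` makes Bałaban's UV stability
UNCONDITIONAL — a real constructive-QFT result; it is NOT the continuum limit and NOT the Clay problem.»  HONEST DEPENDENCY (verbatim): «continuum YM on T⁴ ⇐ BetaPertH ∧ nine spine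
estimates (0/9 proved); BetaPertH ⇐ (D1) ∧ (D4) ∧ CAP+tail; G-an2-4 gates asym, D1 and NE2/3/4.»

WHY (blueprint §4 (E1), note g64 §3 (a) «MIX ∕ M1 words: `c = colM(X)·1 = 0`»): by `DressedSourceZeroModeWords.zmode_dressedSource_inl_inl` the ff zero mode of the dressed source is
`Σ_{u∈box}Σ'_{u′}` of three two-face words in `dM_b = vertexOfK X̃♮ S b + vertexOfM X̃♮ M b`; expanding both slots, every word with a `vertexOfM` factor is killed here, whichever bond
carries it: the lattice-summed bond by the slot zero of `ExchangeSlotResum`, the cell-summed bond by first trading places with the lattice sum (joint covariance).  What is left of the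
two exchange words is the `vertexOfK S ⊗ vertexOfK S` part (`S = S^E + S^VH`: the `S^E ⊗ S^E` numbers of `EEWordValue` ∕ `EEWordSwap`, the `S^VH` cross words located open).

WHAT ([folklore]; generic `d`, in-block root `ρ = toSite r`, `1 ≤ Lc`, every level `j`, all units `s_f s_m`; ANY vertex family `M` at a positive rate; ANY localised other factor `P`
(an5's `Loc`); ANY leg weights `|ρ₁|, |ρ₂| ≤ 1` and fibre legs `a b`; 0 `def`, 0 cited facts, 0 `def … : Prop`, 0 sorry), with `X̃♮_j = unitK s_f s_m (coDressKBmAt ρ Lc (KInvStep Lc j))`,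
`V^M_{κ,u} = vertexOfM X̃♮_j Lc M κ u`, `FF[K] = Σ'_{(y,w)} ρ₁(y)ρ₂(w)·K y w a b`: §1 LATTICE-SUMMED BOND — **`tsum_right_vertexOfM_word_eq_zero`** (`Σ'_{u′} FF[(P ∘ X̃♮_j) ∘ V^M_{ν,u′}] = 0`),
**`tsum_left_vertexOfM_word_eq_zero`** (`Σ'_u FF[(V^M_{μ,u} ∘ X̃♮_j) ∘ P] = 0`); §2 CELL-SUMMED BOND (coarse-covariant `M`, ANY coarse-covariant vertex family `R` in the other slot, `Lc`-periodic
weights) — **`tsum_vertexOfM_left_cov_word_eq_zero`** (`Σ'_{u′} FF[(V^M_{μ,c} ∘ X̃♮_j) ∘ R_{ν,u′}] = 0` for every `c`), **`tsum_vertexOfM_right_cov_word_eq_zero`**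
(`Σ'_{u′} FF[(R_{ν,u′} ∘ X̃♮_j) ∘ V^M_{μ,c}] = 0` for every `c`); hence every cell-and-lattice sum `Σ_{c∈box}Σ'_{u′}` of such a word is `0` (`sum_box_…` corollaries).  Asserts NO value of
Bałaban's tables; discharges NOTHING of (C)sym ∕ (Q-D) ∕ (Q-D-rate) ∕ «T2Shape» ∕ «T2Drift» ∕ (hW, hWall); NEVER «G-an2-4 closed» as (CONV-C); NOT D1, NOT `BetaPertH`, NOT continuum, NOT Clay.
2026-08-23; no existing file touched.
-/

noncomputable section

open Finset
open scoped BigOperators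
open Literature.MathematicalPhysics.QuantumFieldTheory
open Literature.MathematicalPhysics.QuantumFieldTheory.Balaban1983to89
open Literature.MathematicalPhysics.QuantumFieldTheory.Balaban1983to89.Beta
open ExpKernelCalculus (Site MKer comp shiftK Decays BiLoc VertexFamily Zl biLoc_comp_decays)
open OneStepResolventKernel (Fib decays_mono biLoc_mono)
open BalabanStepJetsSucc (biLoc_comp_right)
open OneStepKernelFamily (KInvStep decays_KInvStep)
open SecondOrderResponse (vertexOfM vertexFamily_vertexOfM vertexOfM_shiftK_translate₂)
open AffineAveraging (box toSite)
open Summit.QuantumFields.BalabanUV.Beta.TameKernelCalculus (Loc Spr Tame comp_assoc_tame)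
open Summit.QuantumFields.BalabanUV.Beta.AxialDressingRooted (coDressKBmAt decays_coDressKBmAt)
open Summit.QuantumFields.BalabanUV.Beta.HessKerDressedUnits (unitK decays_unitK)
open Summit.QuantumFields.BalabanUV.Beta.GAN24.EEWordReduced (shiftK_dressedStep)
open Summit.QuantumFields.BalabanUV.Beta.GAN24.DressedMultiplierVertexZero (hasSum_vertexOfM_dressedStep)
open Summit.QuantumFields.BalabanUV.Beta.GAN24.ExchangeSlotResum (tsum_eq_tsum_of_cov twoFace_word_cov_of tsum_slot_word_eq_zero tsum_slot_word_left_eq_zero)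

namespace Summit.QuantumFields.BalabanUV.Beta.GAN24.MultiplierWordsZero

variable {d : ℕ} {Lc : ℕ} [NeZero Lc] {r : Fin (d + 1) → ℕ}

/-! ## §0 Common decay data -/

/-- [folklore] **COMMON-RATE DECAY DATA** (in-block root, `1 ≤ Lc`, level `j`, all units): for a localised `P` (`BiLoc P p q CP δP`, `δP > 0`) and a vertex family `M` at rate `δM > 0`
there is ONE rate `δ > 0` with: `X̃♮_j` decaying at `2δ`, `P` bi-localised at `2δ`, `P ∘ X̃♮_j` bi-localised at `(p, q)` at `δ`, `X̃♮_j ∘ P` bi-localised at `(p, q)` at `δ`, and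
`vertexOfM X̃♮_j Lc M` a vertex family at `δ`. -/
theorem exists_common_data (hLc : 1 ≤ Lc) (hr : r ∈ box (d + 1) Lc) (sf sm : ℝ) (j : ℕ)
    {M : Fin (d + 1) → Site (d + 1) → MKer (d + 1) (Fib d)} {CM δM : ℝ} (hM : VertexFamily M Lc CM δM) (hδM : 0 < δM)
    {P : MKer (d + 1) (Fib d)} {p q : Site (d + 1)} {CP δP : ℝ} (hP : BiLoc P p q CP δP) (hδP : 0 < δP) :
    ∃ δ CX CA CB CQ : ℝ, 0 < δ ∧ 0 ≤ CX ∧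
      Decays (unitK sf sm (coDressKBmAt (toSite r) Lc (KInvStep (d := d) Lc j))) CX (2 * δ) ∧ BiLoc P p q CP (2 * δ) ∧
      BiLoc (comp P (unitK sf sm (coDressKBmAt (toSite r) Lc (KInvStep (d := d) Lc j)))) p q CA δ ∧
      BiLoc (comp (unitK sf sm (coDressKBmAt (toSite r) Lc (KInvStep (d := d) Lc j))) P) p q CB δ ∧
      VertexFamily (vertexOfM (unitK sf sm (coDressKBmAt (toSite r) Lc (KInvStep (d := d) Lc j))) Lc M) Lc CQ δ := by
  obtain ⟨δK, CK, hδK, hCK, hXd⟩ := decays_coDressKBmAt hLc hr (decays_KInvStep (d := d) (Lc := Lc) j)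
  have hXu := decays_unitK (sf := sf) (sm := sm) hXd
  have hCX : 0 ≤ max |sf| |sm| * CK * max |sf| |sm| := by positivity
  have hCP : 0 ≤ CP := hP.nonneg (Sum.inl 0)
  have hCM : 0 ≤ CM := (hM 0 0).nonneg (Sum.inl 0)
  set δ₁ : ℝ := min δP (min δK δM) with hδ₁
  have hδ₁0 : 0 < δ₁ := lt_min hδP (lt_min hδK hδM)
  have h1P : δ₁ ≤ δP := min_le_left _ _
  have h1K : δ₁ ≤ δK := (min_le_right _ _).trans (min_le_left _ _)
  have h1M : δ₁ ≤ δM := (min_le_right _ _).trans (min_le_right _ _)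
  have hP1 : BiLoc P p q CP δ₁ := biLoc_mono hP hCP h1P
  have hX1 : Decays (unitK sf sm (coDressKBmAt (toSite r) Lc (KInvStep (d := d) Lc j))) (max |sf| |sm| * CK * max |sf| |sm|) δ₁ := decays_mono hXu hCX le_rfl h1K
  have hM1 : VertexFamily M Lc CM δ₁ := fun ρ w => biLoc_mono (hM ρ w) hCM h1M
  refine ⟨δ₁ / 2, max |sf| |sm| * CK * max |sf| |sm|, _, _, _, half_pos hδ₁0, hCX, ?_, ?_, biLoc_comp_right hP1 hX1 (half_pos hδ₁0).le (by linarith),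
    biLoc_comp_decays hX1 hP1 (half_pos hδ₁0).le (by linarith), vertexFamily_vertexOfM hX1 hCX hM1 hδ₁0 le_rfl⟩
  · rw [show 2 * (δ₁ / 2) = δ₁ by ring]; exact hX1
  · rw [show 2 * (δ₁ / 2) = δ₁ by ring]; exact hP1

/-! ## §1 The multiplier half-vertex on the lattice-summed bond -/

section Lattice

variable {M : Fin (d + 1) → Site (d + 1) → MKer (d + 1) (Fib d)} {CM δM : ℝ} {P : MKer (d + 1) (Fib d)} {ρ₁ ρ₂ : Site (d + 1) → ℝ}

/-- [folklore] **RIGHT MULTIPLIER SLOT, LATTICE-SUMMED: ZERO.**  For every localised `P`, every vertex family `M` at a positive rate, all bounded weights and fibre legs,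
`Σ'_{u′} Σ'_{(y,w)} ρ₁(y)ρ₂(w)·((P ∘ X̃♮_j) ∘ vertexOfM X̃♮_j Lc M ν u′) y w a b = 0` — `ExchangeSlotResum.tsum_slot_word_eq_zero` with the bond zero
`DressedMultiplierVertexZero.hasSum_vertexOfM_dressedStep` ((S2c) through the dressed kernel). -/
theorem tsum_right_vertexOfM_word_eq_zero (hLc : 1 ≤ Lc) (hr : r ∈ box (d + 1) Lc) (sf sm : ℝ) (j : ℕ) (hM : VertexFamily M Lc CM δM) (hδM : 0 < δM)
    (hP : Loc P) (h₁ : ∀ y, |ρ₁ y| ≤ 1) (h₂ : ∀ w, |ρ₂ w| ≤ 1) (ν : Fin (d + 1)) (a b : Fib d) :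
    ∑' u' : Site (d + 1), ∑' yw : Site (d + 1) × Site (d + 1), ρ₁ yw.1 * ρ₂ yw.2 *
        comp (comp P (unitK sf sm (coDressKBmAt (toSite r) Lc (KInvStep (d := d) Lc j))))
          (vertexOfM (unitK sf sm (coDressKBmAt (toSite r) Lc (KInvStep (d := d) Lc j))) Lc M ν u') yw.1 yw.2 a b = 0 := by
  obtain ⟨p, q, CP, δP, hδP, hPb⟩ := hP
  obtain ⟨δ, CX, CA, CB, CQ, hδ, -, -, -, hA, -, hQ⟩ := exists_common_data hLc hr sf sm j hM hδM hPb hδP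
  exact tsum_slot_word_eq_zero (N := Lc) hδ hA (fun u' => hQ ν u') h₁ h₂ a b (fun z w f => hasSum_vertexOfM_dressedStep hLc hr sf sm j hM hδM ν z w f b)

/-- [folklore] **LEFT MULTIPLIER SLOT, LATTICE-SUMMED: ZERO.**  `Σ'_u Σ'_{(y,w)} ρ₁(y)ρ₂(w)·((vertexOfM X̃♮_j Lc M μ u ∘ X̃♮_j) ∘ P) y w a b = 0` — re-association
(an5's `comp_assoc_tame`: all three factors tame), then `ExchangeSlotResum.tsum_slot_word_left_eq_zero` with the right factor `X̃♮_j ∘ P` and the same bond zero. -/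
theorem tsum_left_vertexOfM_word_eq_zero (hLc : 1 ≤ Lc) (hr : r ∈ box (d + 1) Lc) (sf sm : ℝ) (j : ℕ) (hM : VertexFamily M Lc CM δM) (hδM : 0 < δM)
    (hP : Loc P) (h₁ : ∀ y, |ρ₁ y| ≤ 1) (h₂ : ∀ w, |ρ₂ w| ≤ 1) (μ : Fin (d + 1)) (a b : Fib d) :
    ∑' u : Site (d + 1), ∑' yw : Site (d + 1) × Site (d + 1), ρ₁ yw.1 * ρ₂ yw.2 *
        comp (comp (vertexOfM (unitK sf sm (coDressKBmAt (toSite r) Lc (KInvStep (d := d) Lc j))) Lc M μ u)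
          (unitK sf sm (coDressKBmAt (toSite r) Lc (KInvStep (d := d) Lc j)))) P yw.1 yw.2 a b = 0 := by
  obtain ⟨p, q, CP, δP, hδP, hPb⟩ := hP
  obtain ⟨δ, CX, CA, CB, CQ, hδ, -, hX2, hP2, -, hB, hQ⟩ := exists_common_data hLc hr sf sm j hM hδM hPb hδP
  have h2δ : 0 < 2 * δ := by linarith
  have hTX : Tame (unitK sf sm (coDressKBmAt (toSite r) Lc (KInvStep (d := d) Lc j))) := Spr.tame ⟨_, _, h2δ, hX2⟩
  have hTP : Tame P := Loc.tame ⟨p, q, CP, 2 * δ, h2δ, hP2⟩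
  have hassoc : ∀ u : Site (d + 1), comp (comp (vertexOfM (unitK sf sm (coDressKBmAt (toSite r) Lc (KInvStep (d := d) Lc j))) Lc M μ u)
        (unitK sf sm (coDressKBmAt (toSite r) Lc (KInvStep (d := d) Lc j)))) P =
      comp (vertexOfM (unitK sf sm (coDressKBmAt (toSite r) Lc (KInvStep (d := d) Lc j))) Lc M μ u)
        (comp (unitK sf sm (coDressKBmAt (toSite r) Lc (KInvStep (d := d) Lc j))) P) :=
    fun u => (comp_assoc_tame (Loc.tame ⟨_, _, CQ, δ, hδ, hQ μ u⟩) hTX hTP).symm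
  simp only [hassoc]
  exact tsum_slot_word_left_eq_zero (N := Lc) hδ hB (fun u => hQ μ u) h₁ h₂ a b (fun y z f => hasSum_vertexOfM_dressedStep hLc hr sf sm j hM hδM μ y z a f)

end Lattice

/-! ## §2 The multiplier half-vertex on the cell-summed bond: trade places with the lattice sum first -/

section Cell

variable {M : Fin (d + 1) → Site (d + 1) → MKer (d + 1) (Fib d)} {CM δM : ℝ} {R : Fin (d + 1) → Site (d + 1) → MKer (d + 1) (Fib d)} {CR δR : ℝ}
  {ρ₁ ρ₂ : Site (d + 1) → ℝ}

/-- [folklore] The multiplier half-vertex through the dressed step kernel is coarse-bond covariant when its table is (`vertexOfM_shiftK_translate₂` with `EEWordReduced.shiftK_dressedStep`). -/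
theorem vertexOfM_dressedStep_translate (hLc : 1 ≤ Lc) (sf sm : ℝ) (j : ℕ)
    (hMcov : ∀ (ρ' : Fin (d + 1)) (w t : Site (d + 1)), M ρ' (w + t) = shiftK (-((Lc : ℤ) • t)) (M ρ' w)) (κ : Fin (d + 1)) (u t : Site (d + 1)) :
    vertexOfM (unitK sf sm (coDressKBmAt (toSite r) Lc (KInvStep (d := d) Lc j))) Lc M κ (u + t) =
      shiftK (-((Lc : ℤ) • t)) (vertexOfM (unitK sf sm (coDressKBmAt (toSite r) Lc (KInvStep (d := d) Lc j))) Lc M κ u) := by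
  have h := vertexOfM_shiftK_translate₂ (N := Lc) (unitK sf sm (coDressKBmAt (toSite r) Lc (KInvStep (d := d) Lc j))) (F := M) (G := M) (t := t)
    (fun ρ' w => hMcov ρ' w t) κ u
  rwa [shiftK_dressedStep (r := r) hLc sf sm j t] at h

/-- [folklore] **LEFT MULTIPLIER SLOT ON THE CELL-SUMMED BOND: ZERO** (coarse-covariant `M`; the other slot ANY coarse-covariant vertex family `R` at a positive rate, summed over the
lattice; `Lc`-periodic weights): for every `c`, `Σ'_{u′} FF[(vertexOfM X̃♮_j Lc M μ c ∘ X̃♮_j) ∘ R_{ν,u′}] = 0` — `ExchangeSlotResum.tsum_eq_tsum_of_cov` moves the lattice sum onto the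
multiplier slot (`twoFace_word_cov_of`), then §1. -/
theorem tsum_vertexOfM_left_cov_word_eq_zero (hLc : 1 ≤ Lc) (hr : r ∈ box (d + 1) Lc) (sf sm : ℝ) (j : ℕ) (hM : VertexFamily M Lc CM δM) (hδM : 0 < δM)
    (hMcov : ∀ (ρ' : Fin (d + 1)) (w t : Site (d + 1)), M ρ' (w + t) = shiftK (-((Lc : ℤ) • t)) (M ρ' w))
    (hR : VertexFamily R Lc CR δR) (hδR : 0 < δR) (hRcov : ∀ (κ : Fin (d + 1)) (u t : Site (d + 1)), R κ (u + t) = shiftK (-((Lc : ℤ) • t)) (R κ u))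
    (hρ₁ : ∀ y s : Site (d + 1), ρ₁ (y + (Lc : ℤ) • s) = ρ₁ y) (hρ₂ : ∀ w s : Site (d + 1), ρ₂ (w + (Lc : ℤ) • s) = ρ₂ w)
    (h₁ : ∀ y, |ρ₁ y| ≤ 1) (h₂ : ∀ w, |ρ₂ w| ≤ 1) (μ ν : Fin (d + 1)) (a b : Fib d) (c : Site (d + 1)) :
    ∑' u' : Site (d + 1), ∑' yw : Site (d + 1) × Site (d + 1), ρ₁ yw.1 * ρ₂ yw.2 *
        comp (comp (vertexOfM (unitK sf sm (coDressKBmAt (toSite r) Lc (KInvStep (d := d) Lc j))) Lc M μ c)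
          (unitK sf sm (coDressKBmAt (toSite r) Lc (KInvStep (d := d) Lc j)))) (R ν u') yw.1 yw.2 a b = 0 := by
  have hXs : ∀ t : Site (d + 1), shiftK (-((Lc : ℤ) • t)) (unitK sf sm (coDressKBmAt (toSite r) Lc (KInvStep (d := d) Lc j))) =
      unitK sf sm (coDressKBmAt (toSite r) Lc (KInvStep (d := d) Lc j)) := fun t => shiftK_dressedStep (r := r) hLc sf sm j t
  have hG := tsum_eq_tsum_of_cov (G := fun a' b' => ∑' yw : Site (d + 1) × Site (d + 1), ρ₁ yw.1 * ρ₂ yw.2 *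
        comp (comp (vertexOfM (unitK sf sm (coDressKBmAt (toSite r) Lc (KInvStep (d := d) Lc j))) Lc M μ a')
          (unitK sf sm (coDressKBmAt (toSite r) Lc (KInvStep (d := d) Lc j)))) (R ν b') yw.1 yw.2 a b)
    (fun a' b' t => twoFace_word_cov_of (N := Lc) (fun a'' t' => vertexOfM_dressedStep_translate (r := r) hLc sf sm j hMcov μ a'' t') (fun b'' t' => hRcov ν b'' t') hXs hρ₁ hρ₂ a' b' t a b) c
  rw [← hG]
  exact tsum_left_vertexOfM_word_eq_zero hLc hr sf sm j hM hδM ⟨_, _, CR, δR, hδR, hR ν c⟩ h₁ h₂ μ a b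

/-- [folklore] **RIGHT MULTIPLIER SLOT ON THE CELL-SUMMED BOND: ZERO**: for every `c`, `Σ'_{u′} FF[(R_{ν,u′} ∘ X̃♮_j) ∘ vertexOfM X̃♮_j Lc M μ c] = 0` (covariance swap, then §1). -/
theorem tsum_vertexOfM_right_cov_word_eq_zero (hLc : 1 ≤ Lc) (hr : r ∈ box (d + 1) Lc) (sf sm : ℝ) (j : ℕ) (hM : VertexFamily M Lc CM δM) (hδM : 0 < δM)
    (hMcov : ∀ (ρ' : Fin (d + 1)) (w t : Site (d + 1)), M ρ' (w + t) = shiftK (-((Lc : ℤ) • t)) (M ρ' w))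
    (hR : VertexFamily R Lc CR δR) (hδR : 0 < δR) (hRcov : ∀ (κ : Fin (d + 1)) (u t : Site (d + 1)), R κ (u + t) = shiftK (-((Lc : ℤ) • t)) (R κ u))
    (hρ₁ : ∀ y s : Site (d + 1), ρ₁ (y + (Lc : ℤ) • s) = ρ₁ y) (hρ₂ : ∀ w s : Site (d + 1), ρ₂ (w + (Lc : ℤ) • s) = ρ₂ w)
    (h₁ : ∀ y, |ρ₁ y| ≤ 1) (h₂ : ∀ w, |ρ₂ w| ≤ 1) (μ ν : Fin (d + 1)) (a b : Fib d) (c : Site (d + 1)) :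
    ∑' u' : Site (d + 1), ∑' yw : Site (d + 1) × Site (d + 1), ρ₁ yw.1 * ρ₂ yw.2 *
        comp (comp (R ν u') (unitK sf sm (coDressKBmAt (toSite r) Lc (KInvStep (d := d) Lc j))))
          (vertexOfM (unitK sf sm (coDressKBmAt (toSite r) Lc (KInvStep (d := d) Lc j))) Lc M μ c) yw.1 yw.2 a b = 0 := by
  have hXs : ∀ t : Site (d + 1), shiftK (-((Lc : ℤ) • t)) (unitK sf sm (coDressKBmAt (toSite r) Lc (KInvStep (d := d) Lc j))) =
      unitK sf sm (coDressKBmAt (toSite r) Lc (KInvStep (d := d) Lc j)) := fun t => shiftK_dressedStep (r := r) hLc sf sm j t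
  have hG := tsum_eq_tsum_of_cov (G := fun a' b' => ∑' yw : Site (d + 1) × Site (d + 1), ρ₁ yw.1 * ρ₂ yw.2 *
        comp (comp (R ν a') (unitK sf sm (coDressKBmAt (toSite r) Lc (KInvStep (d := d) Lc j))))
          (vertexOfM (unitK sf sm (coDressKBmAt (toSite r) Lc (KInvStep (d := d) Lc j))) Lc M μ b') yw.1 yw.2 a b)
    (fun a' b' t => twoFace_word_cov_of (N := Lc) (fun a'' t' => hRcov ν a'' t') (fun b'' t' => vertexOfM_dressedStep_translate (r := r) hLc sf sm j hMcov μ b'' t') hXs hρ₁ hρ₂ a' b' t a b) c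
  rw [hG]
  exact tsum_right_vertexOfM_word_eq_zero hLc hr sf sm j hM hδM ⟨_, _, CR, δR, hδR, hR ν c⟩ h₁ h₂ μ a b

/-- [folklore] **IN THE ZERO MODE** (`Σ_{c ∈ box N} Σ'_{u′}`, any period `N`): the cell-and-lattice sum of the word with the multiplier half-vertex on the CELL bond vanishes. -/
theorem sum_box_vertexOfM_left_cov_word_eq_zero (hLc : 1 ≤ Lc) (hr : r ∈ box (d + 1) Lc) (sf sm : ℝ) (j : ℕ) (hM : VertexFamily M Lc CM δM) (hδM : 0 < δM)
    (hMcov : ∀ (ρ' : Fin (d + 1)) (w t : Site (d + 1)), M ρ' (w + t) = shiftK (-((Lc : ℤ) • t)) (M ρ' w))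
    (hR : VertexFamily R Lc CR δR) (hδR : 0 < δR) (hRcov : ∀ (κ : Fin (d + 1)) (u t : Site (d + 1)), R κ (u + t) = shiftK (-((Lc : ℤ) • t)) (R κ u))
    (hρ₁ : ∀ y s : Site (d + 1), ρ₁ (y + (Lc : ℤ) • s) = ρ₁ y) (hρ₂ : ∀ w s : Site (d + 1), ρ₂ (w + (Lc : ℤ) • s) = ρ₂ w)
    (h₁ : ∀ y, |ρ₁ y| ≤ 1) (h₂ : ∀ w, |ρ₂ w| ≤ 1) (μ ν : Fin (d + 1)) (a b : Fib d) (N : ℕ) :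
    ∑ c ∈ box (d + 1) N, ∑' u' : Site (d + 1), ∑' yw : Site (d + 1) × Site (d + 1), ρ₁ yw.1 * ρ₂ yw.2 *
        comp (comp (vertexOfM (unitK sf sm (coDressKBmAt (toSite r) Lc (KInvStep (d := d) Lc j))) Lc M μ (toSite c))
          (unitK sf sm (coDressKBmAt (toSite r) Lc (KInvStep (d := d) Lc j)))) (R ν u') yw.1 yw.2 a b = 0 :=
  Finset.sum_eq_zero fun c _ => tsum_vertexOfM_left_cov_word_eq_zero hLc hr sf sm j hM hδM hMcov hR hδR hRcov hρ₁ hρ₂ h₁ h₂ μ ν a b (toSite c)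

/-- [folklore] **IN THE ZERO MODE**: the cell-and-lattice sum of the word with the multiplier half-vertex on the CELL bond, right position, vanishes. -/
theorem sum_box_vertexOfM_right_cov_word_eq_zero (hLc : 1 ≤ Lc) (hr : r ∈ box (d + 1) Lc) (sf sm : ℝ) (j : ℕ) (hM : VertexFamily M Lc CM δM) (hδM : 0 < δM)
    (hMcov : ∀ (ρ' : Fin (d + 1)) (w t : Site (d + 1)), M ρ' (w + t) = shiftK (-((Lc : ℤ) • t)) (M ρ' w))
    (hR : VertexFamily R Lc CR δR) (hδR : 0 < δR) (hRcov : ∀ (κ : Fin (d + 1)) (u t : Site (d + 1)), R κ (u + t) = shiftK (-((Lc : ℤ) • t)) (R κ u))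
    (hρ₁ : ∀ y s : Site (d + 1), ρ₁ (y + (Lc : ℤ) • s) = ρ₁ y) (hρ₂ : ∀ w s : Site (d + 1), ρ₂ (w + (Lc : ℤ) • s) = ρ₂ w)
    (h₁ : ∀ y, |ρ₁ y| ≤ 1) (h₂ : ∀ w, |ρ₂ w| ≤ 1) (μ ν : Fin (d + 1)) (a b : Fib d) (N : ℕ) :
    ∑ c ∈ box (d + 1) N, ∑' u' : Site (d + 1), ∑' yw : Site (d + 1) × Site (d + 1), ρ₁ yw.1 * ρ₂ yw.2 *
        comp (comp (R ν u') (unitK sf sm (coDressKBmAt (toSite r) Lc (KInvStep (d := d) Lc j))))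
          (vertexOfM (unitK sf sm (coDressKBmAt (toSite r) Lc (KInvStep (d := d) Lc j))) Lc M μ (toSite c)) yw.1 yw.2 a b = 0 :=
  Finset.sum_eq_zero fun c _ => tsum_vertexOfM_right_cov_word_eq_zero hLc hr sf sm j hM hδM hMcov hR hδR hRcov hρ₁ hρ₂ h₁ h₂ μ ν a b (toSite c)

/-- [folklore] **IN THE ZERO MODE**, the words with the multiplier half-vertex on the LATTICE bond vanish cell by cell (no covariance needed). -/
theorem sum_box_vertexOfM_lattice_words_eq_zero (hLc : 1 ≤ Lc) (hr : r ∈ box (d + 1) Lc) (sf sm : ℝ) (j : ℕ) (hM : VertexFamily M Lc CM δM) (hδM : 0 < δM)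
    {P : Fin (d + 1) → Site (d + 1) → MKer (d + 1) (Fib d)} (hP : ∀ κ u, Loc (P κ u)) (h₁ : ∀ y, |ρ₁ y| ≤ 1) (h₂ : ∀ w, |ρ₂ w| ≤ 1) (μ ν : Fin (d + 1))
    (a b : Fib d) (N : ℕ) :
    (∑ c ∈ box (d + 1) N, ∑' u' : Site (d + 1), ∑' yw : Site (d + 1) × Site (d + 1), ρ₁ yw.1 * ρ₂ yw.2 *
        comp (comp (P μ (toSite c)) (unitK sf sm (coDressKBmAt (toSite r) Lc (KInvStep (d := d) Lc j))))
          (vertexOfM (unitK sf sm (coDressKBmAt (toSite r) Lc (KInvStep (d := d) Lc j))) Lc M ν u') yw.1 yw.2 a b = 0) ∧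
    (∑ c ∈ box (d + 1) N, ∑' u' : Site (d + 1), ∑' yw : Site (d + 1) × Site (d + 1), ρ₁ yw.1 * ρ₂ yw.2 *
        comp (comp (vertexOfM (unitK sf sm (coDressKBmAt (toSite r) Lc (KInvStep (d := d) Lc j))) Lc M ν u')
          (unitK sf sm (coDressKBmAt (toSite r) Lc (KInvStep (d := d) Lc j)))) (P μ (toSite c)) yw.1 yw.2 a b = 0) :=
  ⟨Finset.sum_eq_zero fun c _ => tsum_right_vertexOfM_word_eq_zero hLc hr sf sm j hM hδM (hP μ (toSite c)) h₁ h₂ ν a b,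
    Finset.sum_eq_zero fun c _ => tsum_left_vertexOfM_word_eq_zero hLc hr sf sm j hM hδM (hP μ (toSite c)) h₁ h₂ ν a b⟩

end Cell

end Summit.QuantumFields.BalabanUV.Beta.GAN24.MultiplierWordsZero

end
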